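import Mathlib
import HarnessLib
import Summits.HubbardSuperconductivity.HubbardSuperconductivity.Theorems.WeakCouplingBCSKlAllOrdersSelection

/-!
# Route `WeakCouplingBCS` — channel-margin lane of `WcbcsKohnLuttingerB1g` (stmt-HubbardSuperconductivity-0158):
# `B1g` selection to ALL orders on the WHOLE window `μ ∈ [-0.42749, -0.1775]`, modulo the remainder constant `C4 = 10`

Window companion of `Theorems/WeakCouplingBCSKlAllOrdersSelection.lean`.  The 44 window rows `klU0WindowRows`
(`Theorems/WeakCouplingBCSDefsKlU0WindowRecord.lean`, cell file U0-TABLE.md v3) carry, besides their certified third-order and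
resummed-chain data, the ASSUMED remainder constant `C4 = 10` (per `U⁴`, on `0 < U ≤ U1 = 1/16`) — `klaow_rows_consts` below (kernel
decision).  Hence, for EVERY coupling-dependent remainder kernel `R` (the non-chain orders `≥ 4` of the pp-irreducible vertex per `U⁴`)
whose form is `≤ 10 ‖Φ_B‖²` on the `B1g` trial of every record box and `≥ -10` on normalised competitor states for `0 < U ≤ 1/16`, and
modulo the second-order enclosures `klCertB1gWin{A,B,C}.EnclosuresB1g` and the rows' certified `KlResummedWindowEnclosures`:
for every `μ` of the window (⊃ `μ([0.10, 0.20])`), every `0 < U ≤ klU0WindowU = 1145/2²⁴` and every competitor `χ`, the normalised `B1g`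
trial lies strictly below every normalised `χ` state in the full form `resummedForm ε₀ μ U · + U² ⟨·, R U ·⟩`
(`klAllOrders_selection_window`; doping form `klAllOrders_selection_window_doping` for `δ ∈ [0.10, 0.20]` at
`μ(δ) = chemicalPotentialOfDensity ε₀ (1 - δ)`, via `muOfDoping_mem_window_d010_d020`).

Honest framing: `C4` is NOT certified; existence-grade threshold; nothing here asserts a pairing instability.
-/

noncomputable section

-- the tree's namespace `Summit.<Summit>.<Problem>.Theorems` repeats the summit name by design (D-0017)
set_option linter.dupNamespace false

namespace Summit.HubbardSuperconductivity.HubbardSuperconductivity.Theorems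

open MeasureTheory Real Literature.MathematicalPhysics.QuantumLattice CwKLChiralWindow KlThirdOrder

/-- Kernel decision: every window row carries `C4 = 10` and `U1 = 1/16`. [folklore] -/
theorem klaow_rows_consts :
    (klU0WindowRows.all fun w => decide (w.row.C4 = 10) && decide (w.row.U1 = (1 : ℚ) / 16)) = true := by
  decide +kernel

/-- The constants of a window row, unpacked. [folklore] -/
theorem klaow_row_consts (w : KLU0WinRow) (hw : w ∈ klU0WindowRows) :
    (w.row.C4 : ℝ) = 10 ∧ (w.row.U1 : ℝ) = 1 / 16 := by
  have h := List.all_eq_true.1 klaow_rows_consts w hw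
  simp only [Bool.and_eq_true, decide_eq_true_eq] at h
  obtain ⟨h1, h2⟩ := h
  refine ⟨by rw [h1]; push_cast; ring, by rw [h2]; push_cast; ring⟩

/-- **`B1g` selection to ALL orders on the whole window `μ ∈ [-0.42749, -0.1775]` for `0 < U ≤ klU0WindowU = 1145/2²⁴`**, for every
remainder kernel `R` with form bound `10` per `U⁴` on `(0, 1/16]` (on the `B1g` trial of each record box containing `μ`, and on normalised
competitor states), modulo `klCertB1gWin{A,B,C}.EnclosuresB1g` and `KlResummedWindowEnclosures klU0WindowRows [klCertB1gWinA, klCertB1gWinB,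
klCertB1gWinC]`.  `C4 = 10` ASSUMED; existence-grade; nothing here asserts a pairing instability. [cite: RaghuKivelsonScalapino2010, App. A] -/
theorem klAllOrders_selection_window (hA : klCertB1gWinA.EnclosuresB1g) (hB : klCertB1gWinB.EnclosuresB1g)
    (hC : klCertB1gWinC.EnclosuresB1g)
    (h3 : KlResummedWindowEnclosures klU0WindowRows [klCertB1gWinA, klCertB1gWinB, klCertB1gWinC])
    (R : ℝ → Momentum → Momentum → ℝ)
    (hRB : ∀ c ∈ [klCertB1gWinA, klCertB1gWinB, klCertB1gWinC], ∀ bx ∈ c.boxes, ∀ μ : ℝ,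
      ((bx.mulo : ℚ) : ℝ) ≤ μ → μ ≤ ((bx.muhi : ℚ) : ℝ) → ∀ U : ℝ, 0 < U → U ≤ 1 / 16 →
        kform (fermiCurveMeasure (squareDispersion 1 0) μ) (R U) (bx.bB1g.trialFun c.trials) ≤
          10 * ∫ k, bx.bB1g.trialFun c.trials k ^ 2 ∂fermiCurveMeasure (squareDispersion 1 0) μ)
    (hRχ : ∀ μ : ℝ, ((((-42749 : ℚ) / 100000) : ℚ) : ℝ) ≤ μ → μ ≤ ((((-71 : ℚ) / 400) : ℚ) : ℝ) →
      ∀ U : ℝ, 0 < U → U ≤ 1 / 16 → ∀ χ : D4Irrep, χ ≠ D4Irrep.B1g →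
        ∀ φ : Momentum → ℝ, IsChannelState (squareDispersion 1 0) μ χ φ →
          -10 ≤ kform (fermiCurveMeasure (squareDispersion 1 0) μ) (R U) φ) :
    ∀ μ : ℝ, ((((-42749 : ℚ) / 100000) : ℚ) : ℝ) ≤ μ → μ ≤ ((((-71 : ℚ) / 400) : ℚ) : ℝ) →
      ∃ ψ : Momentum → ℝ, IsChannelState (squareDispersion 1 0) μ D4Irrep.B1g ψ ∧
        ∀ U : ℝ, 0 < U → U ≤ ((klU0WindowU : ℚ) : ℝ) → ∀ χ : D4Irrep, χ ≠ D4Irrep.B1g →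
          ∀ φ : Momentum → ℝ, IsChannelState (squareDispersion 1 0) μ χ φ →
            resummedForm (squareDispersion 1 0) μ U ψ + U ^ 2 * kform (fermiCurveMeasure (squareDispersion 1 0) μ) (R U) ψ <
              resummedForm (squareDispersion 1 0) μ U φ + U ^ 2 * kform (fermiCurveMeasure (squareDispersion 1 0) μ) (R U) φ := by
  intro μ hμ₁ hμ₂
  obtain ⟨-, hcov⟩ := klU0Win_cover _ _ _ _ klU0WindowRows_check
  obtain ⟨w, hw, hlo, hhi, hok, hu⟩ := hcov μ hμ₁ hμ₂
  obtain ⟨c, hc, bx, hbx, hcl, hch, hdom⟩ := klThirdOrderWindowJoin_spec _ _ klto_window_join w hw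
  obtain ⟨hcheckc, hEc⟩ := klto_window_recs hA hB hC c hc
  obtain ⟨-, hboxes, -⟩ := klb1gd_coverLogic c hcheckc
  obtain ⟨hBx, -⟩ := hboxes bx hbx
  have hB' := hBx
  simp only [KLBox.basicOKB1gD, Bool.and_eq_true, decide_eq_true_eq] at hB'
  obtain ⟨⟨⟨⟨⟨⟨⟨h4, -⟩, h0⟩, -⟩, -⟩, -⟩, -⟩, -⟩ := hB'
  have hlo' : ((bx.mulo : ℚ) : ℝ) ≤ μ := le_trans (by exact_mod_cast hcl) hlo
  have hhi' : μ ≤ ((bx.muhi : ℚ) : ℝ) := le_trans hhi (by exact_mod_cast hch)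
  have hμ : μ ∈ Set.Ioo (-4 : ℝ) 0 :=
    ⟨lt_of_lt_of_le (by exact_mod_cast h4) hlo', lt_of_le_of_lt hhi' (by exact_mod_cast h0)⟩
  obtain ⟨hER, hEχ⟩ := hEc bx hbx μ ⟨hlo', hhi'⟩
  have h3w := h3 w hw c hc bx hbx hcl hch hdom μ hlo hhi
  obtain ⟨hC4, hU1⟩ := klaow_row_consts w hw
  have hRBw : ∀ U : ℝ, 0 < U → U ≤ w.row.U1 →
      kform (fermiCurveMeasure (squareDispersion 1 0) μ) (R U) (bx.bB1g.trialFun c.trials) ≤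
        (w.row.C4 : ℝ) * ∫ k, bx.bB1g.trialFun c.trials k ^ 2 ∂fermiCurveMeasure (squareDispersion 1 0) μ := by
    intro U hU hUU
    rw [hC4]
    exact hRB c hc bx hbx μ hlo' hhi' U hU (by rw [hU1] at hUU; exact hUU)
  have hRχw : ∀ U : ℝ, 0 < U → U ≤ w.row.U1 → ∀ χ : D4Irrep, χ ≠ D4Irrep.B1g →
      ∀ φ : Momentum → ℝ, IsChannelState (squareDispersion 1 0) μ χ φ →
        -(w.row.C4 : ℝ) ≤ kform (fermiCurveMeasure (squareDispersion 1 0) μ) (R U) φ := by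
    intro U hU hUU χ hχ φ hφ
    rw [hC4]
    exact hRχ μ hμ₁ hμ₂ U hU (by rw [hU1] at hUU; exact hUU) χ hχ φ hφ
  obtain ⟨ψ, hψ, hsel⟩ := klAllOrders_selectionD hμ bx c.trials hBx hER hEχ w.row hok hdom h3w R hRBw hRχw
  exact ⟨ψ, hψ, fun U hU hUu => hsel U hU (le_trans hUu (by exact_mod_cast hu))⟩

/-- **The same indexed by the doping**: for every `δ ∈ [0.10, 0.20]`, at `μ(δ) = chemicalPotentialOfDensity ε₀ (1 - δ)` (∈ the window by
`muOfDoping_mem_window_d010_d020`), `B1g` selection to all orders for `0 < U ≤ klU0WindowU`, for every remainder with form bound `10` per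
`U⁴` on `(0, 1/16]`, modulo the same named hypotheses.  `C4` ASSUMED; nothing here asserts a pairing instability.
[cite: RaghuKivelsonScalapino2010, App. A] -/
theorem klAllOrders_selection_window_doping (hA : klCertB1gWinA.EnclosuresB1g) (hB : klCertB1gWinB.EnclosuresB1g)
    (hC : klCertB1gWinC.EnclosuresB1g)
    (h3 : KlResummedWindowEnclosures klU0WindowRows [klCertB1gWinA, klCertB1gWinB, klCertB1gWinC])
    (R : ℝ → Momentum → Momentum → ℝ)
    (hRB : ∀ c ∈ [klCertB1gWinA, klCertB1gWinB, klCertB1gWinC], ∀ bx ∈ c.boxes, ∀ μ : ℝ,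
      ((bx.mulo : ℚ) : ℝ) ≤ μ → μ ≤ ((bx.muhi : ℚ) : ℝ) → ∀ U : ℝ, 0 < U → U ≤ 1 / 16 →
        kform (fermiCurveMeasure (squareDispersion 1 0) μ) (R U) (bx.bB1g.trialFun c.trials) ≤
          10 * ∫ k, bx.bB1g.trialFun c.trials k ^ 2 ∂fermiCurveMeasure (squareDispersion 1 0) μ)
    (hRχ : ∀ μ : ℝ, ((((-42749 : ℚ) / 100000) : ℚ) : ℝ) ≤ μ → μ ≤ ((((-71 : ℚ) / 400) : ℚ) : ℝ) →
      ∀ U : ℝ, 0 < U → U ≤ 1 / 16 → ∀ χ : D4Irrep, χ ≠ D4Irrep.B1g →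
        ∀ φ : Momentum → ℝ, IsChannelState (squareDispersion 1 0) μ χ φ →
          -10 ≤ kform (fermiCurveMeasure (squareDispersion 1 0) μ) (R U) φ)
    (δ : ℝ) (hδ : δ ∈ Set.Icc (0.10 : ℝ) 0.20) :
    ∃ ψ : Momentum → ℝ,
      IsChannelState (squareDispersion 1 0) (chemicalPotentialOfDensity (squareDispersion 1 0) (1 - δ)) D4Irrep.B1g ψ ∧
        ∀ U : ℝ, 0 < U → U ≤ ((klU0WindowU : ℚ) : ℝ) → ∀ χ : D4Irrep, χ ≠ D4Irrep.B1g →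
          ∀ φ : Momentum → ℝ,
            IsChannelState (squareDispersion 1 0) (chemicalPotentialOfDensity (squareDispersion 1 0) (1 - δ)) χ φ →
              resummedForm (squareDispersion 1 0) (chemicalPotentialOfDensity (squareDispersion 1 0) (1 - δ)) U ψ +
                  U ^ 2 * kform (fermiCurveMeasure (squareDispersion 1 0)
                    (chemicalPotentialOfDensity (squareDispersion 1 0) (1 - δ))) (R U) ψ <
                resummedForm (squareDispersion 1 0) (chemicalPotentialOfDensity (squareDispersion 1 0) (1 - δ)) U φ +
                  U ^ 2 * kform (fermiCurveMeasure (squareDispersion 1 0)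
                    (chemicalPotentialOfDensity (squareDispersion 1 0) (1 - δ))) (R U) φ := by
  obtain ⟨h₁, h₂⟩ := muOfDoping_mem_window_d010_d020 δ hδ
  exact klAllOrders_selection_window hA hB hC h3 R hRB hRχ _ (by push_cast; linarith) (by push_cast; linarith)

end Summit.HubbardSuperconductivity.HubbardSuperconductivity.Theorems

end
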